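import Summits.AtomisticToContinuum.Crystallization.Theorems.FreeSplittingCertificatesStrictSplittingRuleHcpHardyWeightInner
import Summits.AtomisticToContinuum.Crystallization.Theorems.FreeSplittingCertificatesStrictSplittingRuleHcpFamilyMinLocalised

/-!
# `StrictSplittingRule` (stmt-AtomisticToContinuum-12560): the inner-shell Hardy margin AT THE EXACT hcp-family minimiser (box certificate)

Route `FreeSplittingCertificates`, crux r3 `StrictSplittingRule`, line `registered` (unit b2b-freesplit-B, gen 6).  COMPUTATIONAL helper
(`native_decide`, `--computational`).  `…HcpHardyWeightInner.lean` certifies the supersolution margin of the quadratic Hardy profile on the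
inner shells at the RATIONAL PROXY `(a₀,h₀)`; the registered H12⋆ lives at the exact (irrational) family minimiser `(a*,h*)`, which the
tree encloses in the box `|a − 97129/100000| ≤ 10⁻⁴`, `|h − 79294/100000| ≤ 10⁻⁴` (`hcpFamilyMin_enclosure`).  This file transports the
certificate to the whole box by rational INTERVAL ARITHMETIC: with `A = a² ∈ [A⁻,A⁺]`, `H = h² ∈ [H⁻,H⁺]`, every squared norm
`‖y_v‖² = A·Q(v) + k²H` is enclosed by `[A⁻Q + k²H⁻, A⁺Q + k²H⁺]` (`Q ≥ 0`), every bond term `(‖y_x‖⁻⁶ + ‖y_{x_s}‖⁻⁶)(‖y_x‖² − ‖y_{x_s}‖²)`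
is a product of an enclosed positive factor and an enclosed (sign-indefinite, but LINEAR in `(A,H)`) factor, hence at least the minimum
of the four corner products (`mul_ge_min4`), and the sum of these lower bounds is compared with `22·(A⁻Q + k²H⁻)⁻³ ≥ 22·‖y_x‖⁻⁶`:

* `nsqLoQ`, `nsqHiQ`, `termLoQ`, `lapLoQ`, `boxCheck` — the computable enclosures and the per-site Bool test; `boxShell_check` (`native_decide`, 4274 sites with
  `4a₀² ≤ ‖y_x‖²(proxy) < 81a₀²` in the index box `|k|,|i|,|j| ≤ 11`): `0 < nsqLo` everywhere needed and `22·(nsqLo x)⁻³ ≤ lapLo x`;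
* `nsq_mem_box`, `mul_ge_min4` — the real-side enclosure lemmas (with the tree's `hcpQ_nonneg`);
* `hcpHardyWeight_margin_box` — **for every `a, h > 0` with `HcpFamilyMin a h` and every site `x` of the proxy inner shells,
  `22·(‖y_x‖²)⁻³ ≤ Σ_s ((‖y_x‖²)⁻³ + (‖y_{x_s}‖²)⁻³)(‖y_x‖² − ‖y_{x_s}‖²)`** (sites `y = hcpSite a h`), the input of
  `hcpExterior_hardy_of_laplacian` at the TRUE minimiser; interval-certified minimum 22.82.

Structural bookkeeping ([folklore] + a machine check); VALUE = a kernel-accepted certificate at the registered object's parameters — NOT summit progress.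
-/

namespace Summit.AtomisticToContinuum.Crystallization.Theorems.StrictSplittingRuleBirth

open scoped BigOperators
open Literature.MathematicalPhysics.StatisticalMechanics
open Summit.AtomisticToContinuum.Crystallization.Theorems.PalmUnimodularRigidity.LayeredLawsSelectHcp

/-! ## Computable enclosures over the box `a ∈ [0.97119, 0.97139]`, `h ∈ [0.79284, 0.79304]` -/

/-- Lower enclosure of `‖y_v‖²` over the box. [folklore] -/
def nsqLoQ (v : ℤ × ℤ × ℤ) : ℚ := (97119 / 100000 : ℚ) ^ 2 * hcpQq v + (v.1 : ℚ) ^ 2 * (79284 / 100000 : ℚ) ^ 2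

/-- Upper enclosure of `‖y_v‖²` over the box. [folklore] -/
def nsqHiQ (v : ℤ × ℤ × ℤ) : ℚ := (97139 / 100000 : ℚ) ^ 2 * hcpQq v + (v.1 : ℚ) ^ 2 * (79304 / 100000 : ℚ) ^ 2

/-- Lower enclosure of one bond term `(‖y_x‖⁻⁶ + ‖y_w‖⁻⁶)(‖y_x‖² − ‖y_w‖²)` over the box (minimum of the four corner products). [folklore] -/
def termLoQ (x w : ℤ × ℤ × ℤ) : ℚ :=
  min (min ((((nsqHiQ x) ^ 3)⁻¹ + ((nsqHiQ w) ^ 3)⁻¹) *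
          (min ((97119 / 100000 : ℚ) ^ 2 * (hcpQq x - hcpQq w)) ((97139 / 100000 : ℚ) ^ 2 * (hcpQq x - hcpQq w)) +
            min ((79284 / 100000 : ℚ) ^ 2 * ((x.1 : ℚ) ^ 2 - (w.1 : ℚ) ^ 2))
              ((79304 / 100000 : ℚ) ^ 2 * ((x.1 : ℚ) ^ 2 - (w.1 : ℚ) ^ 2))))
        ((((nsqHiQ x) ^ 3)⁻¹ + ((nsqHiQ w) ^ 3)⁻¹) *
          (max ((97119 / 100000 : ℚ) ^ 2 * (hcpQq x - hcpQq w)) ((97139 / 100000 : ℚ) ^ 2 * (hcpQq x - hcpQq w)) +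
            max ((79284 / 100000 : ℚ) ^ 2 * ((x.1 : ℚ) ^ 2 - (w.1 : ℚ) ^ 2))
              ((79304 / 100000 : ℚ) ^ 2 * ((x.1 : ℚ) ^ 2 - (w.1 : ℚ) ^ 2)))))
    (min ((((nsqLoQ x) ^ 3)⁻¹ + ((nsqLoQ w) ^ 3)⁻¹) *
          (min ((97119 / 100000 : ℚ) ^ 2 * (hcpQq x - hcpQq w)) ((97139 / 100000 : ℚ) ^ 2 * (hcpQq x - hcpQq w)) +
            min ((79284 / 100000 : ℚ) ^ 2 * ((x.1 : ℚ) ^ 2 - (w.1 : ℚ) ^ 2))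
              ((79304 / 100000 : ℚ) ^ 2 * ((x.1 : ℚ) ^ 2 - (w.1 : ℚ) ^ 2))))
        ((((nsqLoQ x) ^ 3)⁻¹ + ((nsqLoQ w) ^ 3)⁻¹) *
          (max ((97119 / 100000 : ℚ) ^ 2 * (hcpQq x - hcpQq w)) ((97139 / 100000 : ℚ) ^ 2 * (hcpQq x - hcpQq w)) +
            max ((79284 / 100000 : ℚ) ^ 2 * ((x.1 : ℚ) ^ 2 - (w.1 : ℚ) ^ 2))
              ((79304 / 100000 : ℚ) ^ 2 * ((x.1 : ℚ) ^ 2 - (w.1 : ℚ) ^ 2)))))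

/-- Lower enclosure of the normalised Laplacian over the box. [folklore] -/
def lapLoQ (x : ℤ × ℤ × ℤ) : ℚ := ∑ s ∈ hcpStarIdx, termLoQ x (x + (if x.1 % 2 = 0 then s else -s))

/-- The per-site check (Bool): on the proxy inner shells, positivity of the lower enclosures and `22·(nsqLo x)⁻³ ≤ lapLo x`. [folklore] -/
def boxCheck (x : ℤ × ℤ × ℤ) : Bool :=
  if 4 * (97129 / 100000 : ℚ) ^ 2 ≤ nsqQ x ∧ nsqQ x < 81 * (97129 / 100000 : ℚ) ^ 2 then
    decide (0 < nsqLoQ x) && decide (∀ s ∈ hcpStarIdx, 0 < nsqLoQ (x + (if x.1 % 2 = 0 then s else -s))) &&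
      decide (22 * ((nsqLoQ x) ^ 3)⁻¹ ≤ lapLoQ x)
  else true

/-- **Certificate** over the index box `|k|,|i|,|j| ≤ 11` (4274 sites pass the range test). [folklore] -/
theorem boxShell_check :
    ∀ k ∈ Finset.range 23, ∀ i ∈ Finset.range 23, ∀ j ∈ Finset.range 23,
      boxCheck ((k : ℤ) - 11, (i : ℤ) - 11, (j : ℤ) - 11) = true := by
  native_decide

/-- Unpacking the Bool check. [folklore] -/
theorem boxCheck_spec {x : ℤ × ℤ × ℤ} (hc : boxCheck x = true) (hlo : 4 * (97129 / 100000 : ℚ) ^ 2 ≤ nsqQ x)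
    (hhi : nsqQ x < 81 * (97129 / 100000 : ℚ) ^ 2) :
    0 < nsqLoQ x ∧ (∀ s ∈ hcpStarIdx, 0 < nsqLoQ (x + (if x.1 % 2 = 0 then s else -s))) ∧
      22 * ((nsqLoQ x) ^ 3)⁻¹ ≤ lapLoQ x := by
  unfold boxCheck at hc
  rw [if_pos ⟨hlo, hhi⟩] at hc
  simp only [Bool.and_eq_true, decide_eq_true_eq] at hc
  exact ⟨hc.1.1, hc.1.2, hc.2⟩

/-! ## Real-side enclosure lemmas -/

/-- **Enclosure of the squared norms over the box.** [folklore] -/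
theorem nsq_mem_box {a h : ℝ} (ha : 0 < a) (hh : 0 < h) (hab : |a - 97129 / 100000| ≤ 1 / 10000) (hhb : |h - 79294 / 100000| ≤ 1 / 10000)
    (v : ℤ × ℤ × ℤ) : ((nsqLoQ v : ℚ) : ℝ) ≤ ‖hcpSite a h v‖ ^ 2 ∧ ‖hcpSite a h v‖ ^ 2 ≤ ((nsqHiQ v : ℚ) : ℝ) := by
  obtain ⟨ha1, ha2⟩ := abs_le.1 hab
  obtain ⟨hh1, hh2⟩ := abs_le.1 hhb
  have hA1 : ((97119 : ℝ) / 100000) ^ 2 ≤ a ^ 2 := by nlinarith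
  have hA2 : a ^ 2 ≤ ((97139 : ℝ) / 100000) ^ 2 := by nlinarith
  have hH1 : ((79284 : ℝ) / 100000) ^ 2 ≤ h ^ 2 := by nlinarith
  have hH2 : h ^ 2 ≤ ((79304 : ℝ) / 100000) ^ 2 := by nlinarith
  have hQ := hcpQ_nonneg v
  have hk : 0 ≤ (v.1 : ℝ) ^ 2 := sq_nonneg _
  rw [hcpSite_norm_sq, nsqLoQ, nsqHiQ]
  push_cast
  rw [hcpQq_cast]
  constructor <;> nlinarith [mul_le_mul_of_nonneg_right hA1 hQ, mul_le_mul_of_nonneg_right hA2 hQ,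
    mul_le_mul_of_nonneg_left hH1 hk, mul_le_mul_of_nonneg_left hH2 hk]

/-- **Corner bound for a product** of an enclosed nonnegative factor `u ∈ [ul, uh]` and a factor `v ≥ vl` of any sign (`vh` is any
number; the bound is the minimum of the four corner products). [folklore] -/
theorem mul_ge_min4 {u v ul uh vl : ℝ} (vh : ℝ) (hul : 0 ≤ ul) (hu1 : ul ≤ u) (hu2 : u ≤ uh) (hv1 : vl ≤ v) :
    min (min (ul * vl) (ul * vh)) (min (uh * vl) (uh * vh)) ≤ u * v := by
  rcases le_or_gt 0 v with hv | hv
  · have h1 : ul * vl ≤ ul * v := mul_le_mul_of_nonneg_left hv1 hul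
    have h2 : ul * v ≤ u * v := mul_le_mul_of_nonneg_right hu1 hv
    exact (min_le_left _ _).trans ((min_le_left _ _).trans (h1.trans h2))
  · have huh : 0 ≤ uh := hul.trans (hu1.trans hu2)
    have h1 : uh * vl ≤ uh * v := mul_le_mul_of_nonneg_left hv1 huh
    have h2 : uh * v ≤ u * v := by nlinarith
    exact (min_le_right _ _).trans ((min_le_left _ _).trans (h1.trans h2))

/-- A linear function `A·d` of `A ∈ [Al, Ah]` is enclosed by its endpoint values (any sign of `d`). [folklore] -/
theorem mul_mem_endpoints {A Al Ah d : ℝ} (h1 : Al ≤ A) (h2 : A ≤ Ah) :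
    min (Al * d) (Ah * d) ≤ A * d ∧ A * d ≤ max (Al * d) (Ah * d) := by
  rcases le_or_gt 0 d with hd | hd
  · exact ⟨(min_le_left _ _).trans (mul_le_mul_of_nonneg_right h1 hd),
      (mul_le_mul_of_nonneg_right h2 hd).trans (le_max_right _ _)⟩
  · exact ⟨(min_le_right _ _).trans (by nlinarith), le_trans (by nlinarith) (le_max_left _ _)⟩

/-- **One bond term is at least its enclosure** (when the lower norm enclosures are positive). [folklore] -/
theorem term_ge_termLoQ {a h : ℝ} (ha : 0 < a) (hh : 0 < h) (hab : |a - 97129 / 100000| ≤ 1 / 10000)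
    (hhb : |h - 79294 / 100000| ≤ 1 / 10000) (x w : ℤ × ℤ × ℤ) (hx : 0 < nsqLoQ x) (hw : 0 < nsqLoQ w) :
    ((termLoQ x w : ℚ) : ℝ) ≤
      (((‖hcpSite a h x‖ ^ 2) ^ 3)⁻¹ + ((‖hcpSite a h w‖ ^ 2) ^ 3)⁻¹) * (‖hcpSite a h x‖ ^ 2 - ‖hcpSite a h w‖ ^ 2) := by
  obtain ⟨hx1, hx2⟩ := nsq_mem_box ha hh hab hhb x
  obtain ⟨hw1, hw2⟩ := nsq_mem_box ha hh hab hhb w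
  have hxpos : (0 : ℝ) < ((nsqLoQ x : ℚ) : ℝ) := by exact_mod_cast hx
  have hwpos : (0 : ℝ) < ((nsqLoQ w : ℚ) : ℝ) := by exact_mod_cast hw
  -- the positive factor u and its enclosure
  have hyx : 0 < ‖hcpSite a h x‖ ^ 2 := hxpos.trans_le hx1
  have hyw : 0 < ‖hcpSite a h w‖ ^ 2 := hwpos.trans_le hw1
  have hu1 : (((nsqHiQ x : ℚ) : ℝ) ^ 3)⁻¹ + (((nsqHiQ w : ℚ) : ℝ) ^ 3)⁻¹ ≤
      ((‖hcpSite a h x‖ ^ 2) ^ 3)⁻¹ + ((‖hcpSite a h w‖ ^ 2) ^ 3)⁻¹ :=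
    add_le_add (inv_anti₀ (pow_pos hyx 3) (pow_le_pow_left₀ hyx.le hx2 3))
      (inv_anti₀ (pow_pos hyw 3) (pow_le_pow_left₀ hyw.le hw2 3))
  have hu2 : ((‖hcpSite a h x‖ ^ 2) ^ 3)⁻¹ + ((‖hcpSite a h w‖ ^ 2) ^ 3)⁻¹ ≤
      (((nsqLoQ x : ℚ) : ℝ) ^ 3)⁻¹ + (((nsqLoQ w : ℚ) : ℝ) ^ 3)⁻¹ :=
    add_le_add (inv_anti₀ (pow_pos hxpos 3) (pow_le_pow_left₀ hxpos.le hx1 3))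
      (inv_anti₀ (pow_pos hwpos 3) (pow_le_pow_left₀ hwpos.le hw1 3))
  have hul : (0 : ℝ) ≤ (((nsqHiQ x : ℚ) : ℝ) ^ 3)⁻¹ + (((nsqHiQ w : ℚ) : ℝ) ^ 3)⁻¹ := by
    have : (0 : ℝ) < ((nsqHiQ x : ℚ) : ℝ) := hxpos.trans_le (hx1.trans hx2)
    have : (0 : ℝ) < ((nsqHiQ w : ℚ) : ℝ) := hwpos.trans_le (hw1.trans hw2)
    positivity
  -- the linear factor v = a²(Q x − Q w) + h²(k_x² − k_w²) and its enclosure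
  obtain ⟨ha1, ha2⟩ := abs_le.1 hab
  obtain ⟨hh1, hh2⟩ := abs_le.1 hhb
  have hA1 : ((97119 : ℝ) / 100000) ^ 2 ≤ a ^ 2 := by nlinarith
  have hA2 : a ^ 2 ≤ ((97139 : ℝ) / 100000) ^ 2 := by nlinarith
  have hH1 : ((79284 : ℝ) / 100000) ^ 2 ≤ h ^ 2 := by nlinarith
  have hH2 : h ^ 2 ≤ ((79304 : ℝ) / 100000) ^ 2 := by nlinarith
  have hv : ‖hcpSite a h x‖ ^ 2 - ‖hcpSite a h w‖ ^ 2 = a ^ 2 * (hcpQ x - hcpQ w) + h ^ 2 * ((x.1 : ℝ) ^ 2 - (w.1 : ℝ) ^ 2) := by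
    rw [hcpSite_norm_sq, hcpSite_norm_sq]; ring
  obtain ⟨hvA1, -⟩ := mul_mem_endpoints (d := hcpQ x - hcpQ w) hA1 hA2
  obtain ⟨hvH1, -⟩ := mul_mem_endpoints (d := (x.1 : ℝ) ^ 2 - (w.1 : ℝ) ^ 2) hH1 hH2
  have key := mul_ge_min4
    (max (((97119 : ℝ) / 100000) ^ 2 * (hcpQ x - hcpQ w)) (((97139 : ℝ) / 100000) ^ 2 * (hcpQ x - hcpQ w)) +
      max (((79284 : ℝ) / 100000) ^ 2 * ((x.1 : ℝ) ^ 2 - (w.1 : ℝ) ^ 2)) (((79304 : ℝ) / 100000) ^ 2 * ((x.1 : ℝ) ^ 2 - (w.1 : ℝ) ^ 2)))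
    hul hu1 hu2 (add_le_add hvA1 hvH1)
  rw [← hv] at key
  refine le_trans (le_of_eq ?_) key
  rw [termLoQ]
  push_cast
  rw [hcpQq_cast, hcpQq_cast]

/-- **The inner-shell margin at the exact hcp-family minimiser.**  For `a, h > 0` with `HcpFamilyMin a h` and every index `x` on the
proxy inner shells `4a₀² ≤ ‖y_x(a₀,h₀)‖² < 81a₀²` (equivalently `4·(97129/100000)² ≤ nsqQ x < 81·(97129/100000)²`):
`22·(‖y_x‖²)⁻³ ≤ Σ_s ((‖y_x‖²)⁻³ + (‖y_{x_s}‖²)⁻³)(‖y_x‖² − ‖y_{x_s}‖²)` with `y = hcpSite a h`. [folklore] -/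
theorem hcpHardyWeight_margin_box {a h : ℝ} (ha : 0 < a) (hh : 0 < h) (hfam : HcpFamilyMin a h) (x : ℤ × ℤ × ℤ)
    (hlo : 4 * (97129 / 100000 : ℚ) ^ 2 ≤ nsqQ x) (hhi : nsqQ x < 81 * (97129 / 100000 : ℚ) ^ 2) :
    22 * (((‖hcpSite a h x‖ ^ 2) ^ 3)⁻¹) ≤
      ∑ s ∈ hcpStarIdx, (((‖hcpSite a h x‖ ^ 2) ^ 3)⁻¹ + ((‖hcpSite a h (x + (if Even x.1 then s else -s))‖ ^ 2) ^ 3)⁻¹) *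
        (‖hcpSite a h x‖ ^ 2 - ‖hcpSite a h (x + (if Even x.1 then s else -s))‖ ^ 2) := by
  obtain ⟨hab, hhb⟩ := hcpFamilyMin_enclosure ha hh hfam
  -- index box from the proxy range
  have hhiR : ‖hcpSite (97129 / 100000) (39647 / 50000) x‖ ^ 2 < 81 * (97129 / 100000 : ℝ) ^ 2 := by
    have : ((nsqQ x : ℚ) : ℝ) < ((81 * (97129 / 100000 : ℚ) ^ 2 : ℚ) : ℝ) := by exact_mod_cast hhi
    rw [nsqQ_cast] at this; push_cast at this; exact this
  obtain ⟨⟨hk1, hk2⟩, ⟨hi1, hi2⟩, ⟨hj1, hj2⟩⟩ := innerShell_index_bound hhiR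
  have hxe : x = (((x.1 + 11).toNat : ℤ) - 11, ((x.2.1 + 11).toNat : ℤ) - 11, ((x.2.2 + 11).toNat : ℤ) - 11) := by
    obtain ⟨k, i, j⟩ := x
    simp only at hk1 hk2 hi1 hi2 hj1 hj2 ⊢
    rw [Int.toNat_of_nonneg (by omega), Int.toNat_of_nonneg (by omega), Int.toNat_of_nonneg (by omega)]
    simp
  have key := boxShell_check (x.1 + 11).toNat (Finset.mem_range.2 (by omega)) (x.2.1 + 11).toNat
    (Finset.mem_range.2 (by omega)) (x.2.2 + 11).toNat (Finset.mem_range.2 (by omega))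
  rw [← hxe] at key
  obtain ⟨hx0, hxs0, hcert⟩ := boxCheck_spec key hlo hhi
  have hiff : x.1 % 2 = 0 ↔ Even x.1 := Int.even_iff.symm
  have hite : ∀ s : ℤ × ℤ × ℤ, (if x.1 % 2 = 0 then s else -s) = (if Even x.1 then s else -s) := fun s => by
    by_cases he : Even x.1
    · rw [if_pos (hiff.2 he), if_pos he]
    · rw [if_neg (fun h0 => he (hiff.1 h0)), if_neg he]
  -- lower bound of the Laplacian
  have hlap : ((lapLoQ x : ℚ) : ℝ) ≤
      ∑ s ∈ hcpStarIdx, (((‖hcpSite a h x‖ ^ 2) ^ 3)⁻¹ + ((‖hcpSite a h (x + (if Even x.1 then s else -s))‖ ^ 2) ^ 3)⁻¹) *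
        (‖hcpSite a h x‖ ^ 2 - ‖hcpSite a h (x + (if Even x.1 then s else -s))‖ ^ 2) := by
    rw [lapLoQ]
    push_cast
    refine Finset.sum_le_sum fun s hs => ?_
    rw [hite s]
    have hws := hxs0 s hs
    rw [hite s] at hws
    exact term_ge_termLoQ ha hh hab hhb x _ hx0 hws
  -- upper bound of the left side
  obtain ⟨hx1, -⟩ := nsq_mem_box ha hh hab hhb x
  have hxpos : (0 : ℝ) < ((nsqLoQ x : ℚ) : ℝ) := by exact_mod_cast hx0
  have hleft : 22 * (((‖hcpSite a h x‖ ^ 2) ^ 3)⁻¹) ≤ 22 * ((((nsqLoQ x : ℚ) : ℝ) ^ 3)⁻¹) :=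
    mul_le_mul_of_nonneg_left (inv_anti₀ (pow_pos hxpos 3) (pow_le_pow_left₀ hxpos.le hx1 3)) (by norm_num)
  have hcertR : ((22 * ((nsqLoQ x) ^ 3)⁻¹ : ℚ) : ℝ) ≤ ((lapLoQ x : ℚ) : ℝ) := by exact_mod_cast hcert
  push_cast at hcertR
  exact hleft.trans (hcertR.trans hlap)

end Summit.AtomisticToContinuum.Crystallization.Theorems.StrictSplittingRuleBirth
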